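import Summits.FinalStateConjecture.FinalStateConjecture.Theorems.ZeroEnergyKerrOrBombHawkingExtensionIsKerrNHNoCollar
import HarnessLib

/-!
# Crux `HawkingExtensionIsKerr` (stmt-FinalStateConjecture-17840), line `SketchIdeator2` —
# the typed split A ∧ B of the dock (strategist s1), Theses-free, with child A discharged from the
# spherical-section fact (programme NH, c5)

Helper file of the line lead (c6) landing, as requested by the crux strategist
(`Cruxes/HawkingExtensionIsKerr/STRATEGY-CENSUS.md` § Decomposition, `Lines/strategist_split.lean`,
evidence `ZeroEnergyKerrOrBombHawkingExtensionIsKerrSplit.lean` of 2026-08-17T10:20Z), the glue the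
tenure planner needs for
`ledger route edit route-FinalStateConjecture-ZeroEnergyKerrOrBomb --split HawkingExtensionIsKerr --into children.json --glue-by Summit.FinalStateConjecture.FinalStateConjecture.Theorems.HawkingExtensionIsKerr.SketchIdeator2.hawkingExtensionIsKerr_of_subs`:

* child **A** `DegenerateHorizonTurnsSpacelike` — the analytic core of the degenerate exclusion (= the
  registered r7 stub `stub_noCollar_of_definingFunction` verbatim): a degenerate generator Killing field
  of a vacuum `I⁺`-regular horizon with smooth local defining functions turns spacelike near `𝓔⁺`;
* child **B** `NondegenerateHawkingExtensionIsKerr` — the crux body with the no-collar property of its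
  own collar field as ONE extra hypothesis (inserted after the collar-timelike clause);
* `hawkingExtensionIsKerr_of_subs : A → B → <crux body>` — the glue (B's extra hypothesis is A composed
  with the landed local defining functions of the horizon, `stub_hr_assembly`, p151777);
* `nondegenerateHawkingExtensionIsKerr_of_four_facts` — B from the four classical uniqueness facts
  (`SudarskyWald1993_staticity`, `ChruscielGalloway2010_docStaticUniqueness`,
  `Chrusciel1997_docAxisymmetricCombination`, `ChruscielCostaHeusler2012_docAxisymmetricUniqueness`),
  sorry-free, via `collarSurfaceGravity_of_noCollarHyp` (collar surface gravity from the POINTWISE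
  no-collar hypothesis and the proved collar zeroth law p144641);
* `degenerateHorizonTurnsSpacelike_of_horizonSphericalSection` — NEW w.r.t. the strategist's file:
  A from the single named fact `chruscielCosta2008_horizonSphericalSection` (Chruściel–Costa 2008
  Thm 4.11 / Prop 4.3 / Cor 2.5) by c5's NH assembly (`stub_nh_assembly`, p157154) and null Gauss
  equation (`stub_nh_gaussNull`, p159146).

So after the split: A is closed modulo ONE accepted Literature fact, B modulo FOUR, and the parent by
`hawkingExtensionIsKerr_of_subs`.  All statements are closed Props with the route-decl body inlined
verbatim (no `Theses` import: the gate re-renders the route file).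
-/

noncomputable section

set_option linter.dupNamespace false

namespace Summit.FinalStateConjecture.FinalStateConjecture.Theorems.HawkingExtensionIsKerr.SketchIdeator2

open Set Function Literature.Geometry.Lorentzian
open scoped Manifold ContDiff Topology

/-! ## B is closed modulo the four classical uniqueness facts -/

/-- Collar surface gravity from the POINTWISE no-collar hypothesis (cf. `collarSurfaceGravity_of_collar`,
p144689): P5 nullity/tangency, the proved collar zeroth law (p144641), and `κ ≠ 0` from the hypothesis. -/
theorem collarSurfaceGravity_of_noCollarHyp (𝓑 : StationaryAFBlackHole.{0})
    [𝓑.metric.HasLeviCivita] (hvac : 𝓑.metric.toPseudoRiemannianMetric.IsRicciFlat)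
    (hfut : ∀ p : 𝓑.carrier, p ∈ 𝓑.metric.chronologicalFuture 𝓑.timeOrientation 𝓑.Mext)
    {U U' : Set 𝓑.carrier} {K K' : Π x : 𝓑.carrier, TangentSpace (𝓡 4) x}
    (hU : IsOpen U) (hHU : 𝓑.horizon ⊆ U) (hconn : IsConnected 𝓑.horizon)
    (hKon : 𝓑.metric.toPseudoRiemannianMetric.IsKillingFieldOn K U)
    (hKne : ∀ p ∈ 𝓑.horizon, K p ≠ 0)
    (hKtl : ∀ x ∈ U ∩ 𝓑.doc, 𝓑.metric.val x (K x) (K x) < 0)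
    (hNC : (∀ p ∈ 𝓑.horizon, 𝓑.metric.val p (K p) (K p) = 0) →
      (∀ p ∈ 𝓑.horizon, ∃ ε > (0 : ℝ), ∃ γ : ℝ → 𝓑.carrier, γ 0 = p ∧
        IsMIntegralCurveOn γ K (Set.Ioo (-ε) ε) ∧ ∀ t ∈ Set.Ioo (-ε) ε, γ t ∈ 𝓑.horizon) →
      (∀ p ∈ 𝓑.horizon, 𝓑.metric.leviCivita K p (K p) = 0) →
      ∀ V : Set 𝓑.carrier, IsOpen V → 𝓑.horizon ⊆ V →
        ∃ x ∈ V ∩ 𝓑.doc, 0 < 𝓑.metric.val x (K x) (K x))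
    (hU' : IsOpen U') (hHU' : 𝓑.horizon ⊆ U') (hK'K : ∀ x ∈ U' ∩ 𝓑.doc, K' x = K x)
    (hK'on : 𝓑.metric.toPseudoRiemannianMetric.IsKillingFieldOn K' 𝓑.doc)
    (hK'comp : ∀ x ∈ 𝓑.doc, ∃ δ : ℝ → 𝓑.carrier, IsMIntegralCurve δ K' ∧ δ 0 = x ∧
      ∀ t, δ t ∈ 𝓑.doc) :
    ∃ κ : ℝ, κ ≠ 0 ∧ ∀ p ∈ 𝓑.horizon, 𝓑.metric.leviCivita K p (K p) = κ • K p := by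
  have hNT := stub_collarNullTangent 𝓑 hfut U U' K K' hU hHU hKon hKtl hU' hHU' hK'K hK'on hK'comp
  have hnull : ∀ p ∈ 𝓑.horizon, 𝓑.metric.val p (K p) (K p) = 0 := fun p hp ↦ (hNT p hp).1
  have htan : ∀ p ∈ 𝓑.horizon, ∃ ε > (0 : ℝ), ∃ γ : ℝ → 𝓑.carrier, γ 0 = p ∧
      IsMIntegralCurveOn γ K (Set.Ioo (-ε) ε) ∧ ∀ t ∈ Set.Ioo (-ε) ε, γ t ∈ 𝓑.horizon :=
    fun p hp ↦ (hNT p hp).2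
  obtain ⟨κ, hκ⟩ := vacuumHorizonZerothLaw_of_collar 𝓑 hvac hconn hU hHU hKon hKne hnull hKtl
  refine ⟨κ, ?_, hκ⟩
  rintro rfl
  obtain ⟨x, hx, hpos⟩ := hNC hnull htan (fun p hp ↦ by rw [hκ p hp, zero_smul]) U hU hHU
  exact absurd (hKtl x hx) (not_lt.mpr hpos.le)

/-- **B from the four facts** (`SudarskyWald1993_staticity`, `ChruscielGalloway2010_docStaticUniqueness`,
`Chrusciel1997_docAxisymmetricCombination`, `ChruscielCostaHeusler2012_docAxisymmetricUniqueness`),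
sorry-free: the day their `_holds` land, child B closes by `exact`.  (Strategist s1; the proof of
`hawkingExtensionIsKerr_of_five_facts`, p144689, with the pointwise hypothesis in place of the global fact.) -/
theorem nondegenerateHawkingExtensionIsKerr_of_four_facts :
    SudarskyWald1993_staticity → ChruscielGalloway2010_docStaticUniqueness → Chrusciel1997_docAxisymmetricCombination → ChruscielCostaHeusler2012_docAxisymmetricUniqueness → ∀ (𝓑 : Literature.Geometry.Lorentzian.StationaryAFBlackHole.{0}) [𝓑.metric.HasLeviCivita] [Literature.Geometry.Lorentzian.Kerr.Facts], 𝓑.metric.toPseudoRiemannianMetric.IsRicciFlat → 𝓑.IsIPlusRegular → (∀ p : 𝓑.carrier, p ∈ 𝓑.metric.chronologicalFuture 𝓑.timeOrientation 𝓑.Mext) → (∀ p ∈ 𝓑.doc, 𝓑.killing p ≠ 0) → SimplyConnectedSpace 𝓑.doc → ∀ (U : Set 𝓑.carrier) (K : Π x : 𝓑.carrier, TangentSpace (𝓡 4) x), IsOpen U → 𝓑.horizon ⊆ U → IsConnected 𝓑.horizon → ContMDiffOn (𝓡 4) ((𝓡 4).prod 𝓘(ℝ, Literature.Geometry.Lorentzian.E4))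 ((⊤ : ℕ∞) : WithTop ℕ∞) (fun x ↦ (Bundle.TotalSpace.mk' Literature.Geometry.Lorentzian.E4 x (K x) : TangentBundle (𝓡 4) 𝓑.carrier)) U → (∀ x ∈ U, ∀ v w : TangentSpace (𝓡 4) x, 𝓑.metric.val x (𝓑.metric.leviCivita K x v) w + 𝓑.metric.val x v (𝓑.metric.leviCivita K x w) = 0) → (∀ x ∈ U, VectorField.mlieBracket (𝓡 4) 𝓑.killing K x = 0) → (∀ p ∈ 𝓑.horizon, K p ≠ 0) → (∀ γ : ℝ → 𝓑.carrier, IsMIntegralCurve γ K → γ 0 ∈ 𝓑.horizon → ∀ t, γ t ∈ 𝓑.horizon) → (∀ x ∈ U ∩ 𝓑.doc, 𝓑.metric.val x (K x) (K x) < 0) → ((∀ p ∈ 𝓑.horizon, 𝓑.metric.val p (K p) (K p) = 0) → (∀ p ∈ 𝓑.horizon, ∃ ε > (0 : ℝ), ∃ γ : ℝ → 𝓑.carrier, γ 0 = p ∧ IsMIntegralCurveOn γ K (Set.Ioo (-ε) ε) ∧ ∀ t ∈ Set.Ioo (-ε) ε, γ t ∈ 𝓑.horizon) → (∀ p ∈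 𝓑.horizon, 𝓑.metric.leviCivita K p (K p) = 0) → ∀ V : Set 𝓑.carrier, IsOpen V → 𝓑.horizon ⊆ V → ∃ x ∈ V ∩ 𝓑.doc, 0 < 𝓑.metric.val x (K x) (K x)) → (∃ K' : Π x : 𝓑.carrier, TangentSpace (𝓡 4) x, ContMDiffOn (𝓡 4) ((𝓡 4).prod 𝓘(ℝ, Literature.Geometry.Lorentzian.E4)) ((⊤ : ℕ∞) : WithTop ℕ∞) (fun x ↦ (Bundle.TotalSpace.mk' Literature.Geometry.Lorentzian.E4 x (K' x) : TangentBundle (𝓡 4) 𝓑.carrier)) 𝓑.doc ∧ (∀ x ∈ 𝓑.doc, ∀ v w : TangentSpace (𝓡 4) x, 𝓑.metric.val x (𝓑.metric.leviCivita K' x v) w + 𝓑.metric.val x v (𝓑.metric.leviCivita K' x w) = 0) ∧ (∀ x ∈ 𝓑.doc, VectorField.mlieBracket (𝓡 4) 𝓑.killing K' x = 0) ∧ ∃ U' : Set 𝓑.carrier, IsOpen U' ∧ 𝓑.horizon ⊆ U' ∧ ∀ x ∈ U' ∩ 𝓑.doc, K' x = K x) → ∃ (M a : ℝ), Literature.Geometry.Lorentzian.Kerr.IsSubextremal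 M a ∧ ∃ Ψ : Literature.Geometry.Lorentzian.Kerr.exterior M a → 𝓑.carrier, Function.Injective Ψ ∧ Set.range Ψ = 𝓑.doc ∧ Literature.Geometry.Lorentzian.PseudoRiemannianMetric.IsIsometricImmersion (Literature.Geometry.Lorentzian.Kerr.smoothMetric M a (Literature.Geometry.Lorentzian.Kerr.rPlus M a)).toPseudoRiemannianMetric 𝓑.metric.toPseudoRiemannianMetric Ψ := by
  intro h₁ h₂ hCh97 hCCH 𝓑 _ _ hvac hreg hfut hT hsc U K hU hHU hconn hKs hKk hKc hKne hKtan hKtl hNC hext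
  obtain ⟨K', hK's, hK'k, hK'c, U', hU', hHU', hK'K⟩ := hext
  have hKon : 𝓑.metric.toPseudoRiemannianMetric.IsKillingFieldOn K U := ⟨hKs, hKk⟩
  have hK'on : 𝓑.metric.toPseudoRiemannianMetric.IsKillingFieldOn K' 𝓑.doc := ⟨hK's, hK'k⟩
  classical
  by_cases hrot : ∃ c : ℝ, ∀ x ∈ 𝓑.doc, K' x = c • 𝓑.killing x
  · obtain ⟨c, hc⟩ := hrot
    obtain ⟨κ, hκ, hκK⟩ := collarSurfaceGravity_of_noCollarHyp 𝓑 hvac hfut hU hHU hconn hKon hKne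
      hKtl hNC hU' hHU' hK'K hK'on (docComplete_of_nonrotating 𝓑 hc)
    obtain ⟨hc0, hTne, hTκ⟩ := stub_horizonKilling_of_nonrotating 𝓑 U U' K K' c κ hU hHU hKon hU'
      hHU' hK'K hc hKne hκK hconn.nonempty
    exact kerrConclusion_of_nonrotating h₁ h₂ 𝓑 hvac hreg hconn hTne
      ⟨c⁻¹ * κ, mul_ne_zero (inv_ne_zero hc0) hκ, hTκ⟩
  · obtain ⟨a, b, hb, hper, hax⟩ := hCh97 𝓑 hvac hreg hconn hsc K' hK'on hK'c hrot
    obtain ⟨κ, hκ, hκK⟩ := collarSurfaceGravity_of_noCollarHyp 𝓑 hvac hfut hU hHU hconn hKon hKne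
      hKtl hNC hU' hHU' hK'K hK'on (stub_docComplete_of_axial 𝓑 K' a b hreg hK'on hK'c hb hper)
    have ha : a ≠ 0 := stub_axialCollar_ne_zero 𝓑 U U' K K' a b hreg hconn hU hHU hKon hKtl hU'
      hHU' hK'K hK'on hb hper
    obtain ⟨hΦon, hΦc, hΦnt, hUU', hHUU', hχon, hχeq, hχne, hχtan, hκ', hχκ⟩ :=
      stub_axialCollar_prep 𝓑 U U' K K' a b κ hU hHU hKon hKc hKne hKtan hU' hHU' hK'K hK'on hK'c
        hrot ha hb hκ hκK
    exact Theorems.ZeroEnergyRigidity.GlobalHorizonKillingField.KerrChartTransfer.stub_kerrChartTransfer 𝓑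
      (hCCH 𝓑 LorentzianMetric.isOpen_chronologicalFuture_holds_of_boundaryless
        LorentzianMetric.isOpen_chronologicalPast_holds_of_boundaryless
        PseudoRiemannianMetric.contMDiff_restrict_holds hreg hconn hvac hsc
        (a • 𝓑.killing + b • K') hΦon hΦc hper hax hΦnt (U ∩ U') ((-(b / a)) • K) (-a⁻¹)
        (-(b / a) * κ) hUU' hHUU' hχon hχeq hχne hχtan hκ' hχκ)

/-! ## The glue: the crux body from A and B -/

/-- **`ZeroEnergyKerrOrBomb.HawkingExtensionIsKerr` (rev 9 body, verbatim) from child A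
(`DegenerateHorizonTurnsSpacelike`) and child B (`NondegenerateHawkingExtensionIsKerr`)**: B's extra
hypothesis is A composed with the landed local defining functions of the horizon (`stub_hr_assembly`,
p151777).  Strategist s1's glue, Theses-free. -/
theorem hawkingExtensionIsKerr_of_subs :
    (∀ (𝓑 : Literature.Geometry.Lorentzian.StationaryAFBlackHole.{0}) [𝓑.metric.HasLeviCivita], 𝓑.metric.toPseudoRiemannianMetric.IsRicciFlat → 𝓑.IsIPlusRegular → IsConnected 𝓑.horizon → SimplyConnectedSpace 𝓑.doc → ∀ (U : Set 𝓑.carrier) (K : Π x : 𝓑.carrier, TangentSpace (𝓡 4) x), IsOpen U → 𝓑.horizon ⊆ U → Literature.Geometry.Lorentzian.PseudoRiemannianMetric.IsKillingFieldOn 𝓑.metric.toPseudoRiemannianMetric K U → (∀ x ∈ U, VectorField.mlieBracket (𝓡 4) 𝓑.killing K x = 0) → (∀ p ∈ 𝓑.horizon, K p ≠ 0) → (∀ p ∈ 𝓑.horizon, 𝓑.metric.val p (K p) (K p) = 0) → (∀ p ∈ 𝓑.horizon, ∃ ε > (0 : ℝ), ∃ γ : ℝ → 𝓑.carrier, γ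 0 = p ∧ IsMIntegralCurveOn γ K (Set.Ioo (-ε) ε) ∧ ∀ t ∈ Set.Ioo (-ε) ε, γ t ∈ 𝓑.horizon) → (∀ p ∈ 𝓑.horizon, 𝓑.metric.leviCivita K p (K p) = 0) → (∀ p ∈ 𝓑.horizon, ∃ W : Set 𝓑.carrier, IsOpen W ∧ p ∈ W ∧ W ⊆ U ∧ ∃ F : 𝓑.carrier → ℝ, ContMDiffOn (𝓡 4) 𝓘(ℝ, ℝ) ((⊤ : ℕ∞) : WithTop ℕ∞) F W ∧ (∀ x ∈ W, x ∈ 𝓑.horizon ↔ F x = 0) ∧ (∀ x ∈ W, x ∈ 𝓑.doc ↔ F x < 0) ∧ ∀ x ∈ W ∩ 𝓑.horizon, ∃ c : ℝ, c ≠ 0 ∧ ∀ w : TangentSpace (𝓡 4) x, mfderiv (𝓡 4) 𝓘(ℝ, ℝ) F x w = c * 𝓑.metric.val x (K x) w) → ∀ V : Set 𝓑.carrier, IsOpen V → 𝓑.horizon ⊆ V → ∃ x ∈ V ∩ 𝓑.doc, 0 < 𝓑.metric.val x (K x) (K x)) → (∀ (𝓑 : Literature.Geometry.Lorentzian.StationaryAFBlackHole.{0})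 [𝓑.metric.HasLeviCivita] [Literature.Geometry.Lorentzian.Kerr.Facts], 𝓑.metric.toPseudoRiemannianMetric.IsRicciFlat → 𝓑.IsIPlusRegular → (∀ p : 𝓑.carrier, p ∈ 𝓑.metric.chronologicalFuture 𝓑.timeOrientation 𝓑.Mext) → (∀ p ∈ 𝓑.doc, 𝓑.killing p ≠ 0) → SimplyConnectedSpace 𝓑.doc → ∀ (U : Set 𝓑.carrier) (K : Π x : 𝓑.carrier, TangentSpace (𝓡 4) x), IsOpen U → 𝓑.horizon ⊆ U → IsConnected 𝓑.horizon → ContMDiffOn (𝓡 4) ((𝓡 4).prod 𝓘(ℝ, Literature.Geometry.Lorentzian.E4)) ((⊤ : ℕ∞) : WithTop ℕ∞) (fun x ↦ (Bundle.TotalSpace.mk' Literature.Geometry.Lorentzian.E4 x (K x) : TangentBundle (𝓡 4) 𝓑.carrier)) U → (∀ x ∈ U, ∀ v w : TangentSpace (𝓡 4) x, 𝓑.metric.val x (𝓑.metric.leviCivita K x v) w + 𝓑.metric.val x v (𝓑.metric.leviCivita K x w) = 0) → (∀ x ∈ U, VectorField.mlieBracket (𝓡 4) 𝓑.killing K x =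 0) → (∀ p ∈ 𝓑.horizon, K p ≠ 0) → (∀ γ : ℝ → 𝓑.carrier, IsMIntegralCurve γ K → γ 0 ∈ 𝓑.horizon → ∀ t, γ t ∈ 𝓑.horizon) → (∀ x ∈ U ∩ 𝓑.doc, 𝓑.metric.val x (K x) (K x) < 0) → ((∀ p ∈ 𝓑.horizon, 𝓑.metric.val p (K p) (K p) = 0) → (∀ p ∈ 𝓑.horizon, ∃ ε > (0 : ℝ), ∃ γ : ℝ → 𝓑.carrier, γ 0 = p ∧ IsMIntegralCurveOn γ K (Set.Ioo (-ε) ε) ∧ ∀ t ∈ Set.Ioo (-ε) ε, γ t ∈ 𝓑.horizon) → (∀ p ∈ 𝓑.horizon, 𝓑.metric.leviCivita K p (K p) = 0) → ∀ V : Set 𝓑.carrier, IsOpen V → 𝓑.horizon ⊆ V → ∃ x ∈ V ∩ 𝓑.doc, 0 < 𝓑.metric.val x (K x) (K x)) → (∃ K' : Π x : 𝓑.carrier, TangentSpace (𝓡 4) x, ContMDiffOn (𝓡 4) ((𝓡 4).prod 𝓘(ℝ, Literature.Geometry.Lorentzian.E4)) ((⊤ : ℕ∞) : WithTop ℕ∞)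 (fun x ↦ (Bundle.TotalSpace.mk' Literature.Geometry.Lorentzian.E4 x (K' x) : TangentBundle (𝓡 4) 𝓑.carrier)) 𝓑.doc ∧ (∀ x ∈ 𝓑.doc, ∀ v w : TangentSpace (𝓡 4) x, 𝓑.metric.val x (𝓑.metric.leviCivita K' x v) w + 𝓑.metric.val x v (𝓑.metric.leviCivita K' x w) = 0) ∧ (∀ x ∈ 𝓑.doc, VectorField.mlieBracket (𝓡 4) 𝓑.killing K' x = 0) ∧ ∃ U' : Set 𝓑.carrier, IsOpen U' ∧ 𝓑.horizon ⊆ U' ∧ ∀ x ∈ U' ∩ 𝓑.doc, K' x = K x) → ∃ (M a : ℝ), Literature.Geometry.Lorentzian.Kerr.IsSubextremal M a ∧ ∃ Ψ : Literature.Geometry.Lorentzian.Kerr.exterior M a → 𝓑.carrier, Function.Injective Ψ ∧ Set.range Ψ = 𝓑.doc ∧ Literature.Geometry.Lorentzian.PseudoRiemannianMetric.IsIsometricImmersion (Literature.Geometry.Lorentzian.Kerr.smoothMetric M a (Literature.Geometry.Lorentzian.Kerr.rPlus M a)).toPseudoRiemannianMetric 𝓑.metric.toPseudoRiemannianMetric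 Ψ) → ∀ (𝓑 : Literature.Geometry.Lorentzian.StationaryAFBlackHole.{0}) [𝓑.metric.HasLeviCivita] [Literature.Geometry.Lorentzian.Kerr.Facts], 𝓑.metric.toPseudoRiemannianMetric.IsRicciFlat → 𝓑.IsIPlusRegular → (∀ p : 𝓑.carrier, p ∈ 𝓑.metric.chronologicalFuture 𝓑.timeOrientation 𝓑.Mext) → (∀ p ∈ 𝓑.doc, 𝓑.killing p ≠ 0) → SimplyConnectedSpace 𝓑.doc → ∀ (U : Set 𝓑.carrier) (K : Π x : 𝓑.carrier, TangentSpace (𝓡 4) x), IsOpen U → 𝓑.horizon ⊆ U → IsConnected 𝓑.horizon → ContMDiffOn (𝓡 4) ((𝓡 4).prod 𝓘(ℝ, Literature.Geometry.Lorentzian.E4)) ((⊤ : ℕ∞) : WithTop ℕ∞) (fun x ↦ (Bundle.TotalSpace.mk' Literature.Geometry.Lorentzian.E4 x (K x) : TangentBundle (𝓡 4) 𝓑.carrier)) U → (∀ x ∈ U, ∀ v w : TangentSpace (𝓡 4) x, 𝓑.metric.val x (𝓑.metric.leviCivita K x v) w + 𝓑.metric.val x v (𝓑.metric.leviCivita K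 x w) = 0) → (∀ x ∈ U, VectorField.mlieBracket (𝓡 4) 𝓑.killing K x = 0) → (∀ p ∈ 𝓑.horizon, K p ≠ 0) → (∀ γ : ℝ → 𝓑.carrier, IsMIntegralCurve γ K → γ 0 ∈ 𝓑.horizon → ∀ t, γ t ∈ 𝓑.horizon) → (∀ x ∈ U ∩ 𝓑.doc, 𝓑.metric.val x (K x) (K x) < 0) → (∃ K' : Π x : 𝓑.carrier, TangentSpace (𝓡 4) x, ContMDiffOn (𝓡 4) ((𝓡 4).prod 𝓘(ℝ, Literature.Geometry.Lorentzian.E4)) ((⊤ : ℕ∞) : WithTop ℕ∞) (fun x ↦ (Bundle.TotalSpace.mk' Literature.Geometry.Lorentzian.E4 x (K' x) : TangentBundle (𝓡 4) 𝓑.carrier)) 𝓑.doc ∧ (∀ x ∈ 𝓑.doc, ∀ v w : TangentSpace (𝓡 4) x, 𝓑.metric.val x (𝓑.metric.leviCivita K' x v) w + 𝓑.metric.val x v (𝓑.metric.leviCivita K' x w) = 0) ∧ (∀ x ∈ 𝓑.doc, VectorField.mlieBracket (𝓡 4) 𝓑.killing K' x = 0) ∧ ∃ U' : Set 𝓑.carrier,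 IsOpen U' ∧ 𝓑.horizon ⊆ U' ∧ ∀ x ∈ U' ∩ 𝓑.doc, K' x = K x) → ∃ (M a : ℝ), Literature.Geometry.Lorentzian.Kerr.IsSubextremal M a ∧ ∃ Ψ : Literature.Geometry.Lorentzian.Kerr.exterior M a → 𝓑.carrier, Function.Injective Ψ ∧ Set.range Ψ = 𝓑.doc ∧ Literature.Geometry.Lorentzian.PseudoRiemannianMetric.IsIsometricImmersion (Literature.Geometry.Lorentzian.Kerr.smoothMetric M a (Literature.Geometry.Lorentzian.Kerr.rPlus M a)).toPseudoRiemannianMetric 𝓑.metric.toPseudoRiemannianMetric Ψ := by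
  intro hA hB 𝓑 _ _ hvac hreg hfut hT hsc U K hU hHU hconn hKs hKk hKc hKne hKtan hKtl hext
  refine hB 𝓑 hvac hreg hfut hT hsc U K hU hHU hconn hKs hKk hKc hKne hKtan hKtl ?_ hext
  intro hnull htan hdeg V hV hHV
  exact hA 𝓑 hvac hreg hconn hsc U K hU hHU ⟨hKs, hKk⟩ hKc hKne hnull htan hdeg
    (stub_hr_assembly 𝓑 U K hU hHU hKs hKne hnull htan) V hV hHV

/-! ## Child A from the spherical-section fact (programme NH, c5) -/

/-- **Child A (`DegenerateHorizonTurnsSpacelike`) from the named fact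
`chruscielCosta2008_horizonSphericalSection`** (Chruściel–Costa 2008 Thm 4.11 / Prop 4.3 / Cor 2.5): the
NH assembly `stub_nh_assembly` (p157154) at the null Gauss equation `stub_nh_gaussNull` (p159146). -/
theorem degenerateHorizonTurnsSpacelike_of_horizonSphericalSection : chruscielCosta2008_horizonSphericalSection → ∀ (𝓑 : Literature.Geometry.Lorentzian.StationaryAFBlackHole.{0}) [𝓑.metric.HasLeviCivita], 𝓑.metric.toPseudoRiemannianMetric.IsRicciFlat → 𝓑.IsIPlusRegular → IsConnected 𝓑.horizon → SimplyConnectedSpace 𝓑.doc → ∀ (U : Set 𝓑.carrier) (K : Π x : 𝓑.carrier, TangentSpace (𝓡 4) x), IsOpen U → 𝓑.horizon ⊆ U → Literature.Geometry.Lorentzian.PseudoRiemannianMetric.IsKillingFieldOn 𝓑.metric.toPseudoRiemannianMetric K U → (∀ x ∈ U, VectorField.mlieBracket (𝓡 4) 𝓑.killing K x = 0) → (∀ p ∈ 𝓑.horizon, K p ≠ 0) → (∀ p ∈ 𝓑.horizon, 𝓑.metric.val p (K p) (K p) = 0) → (∀ p ∈ 𝓑.horizon, ∃ ε > (0 : ℝ),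 ∃ γ : ℝ → 𝓑.carrier, γ 0 = p ∧ IsMIntegralCurveOn γ K (Set.Ioo (-ε) ε) ∧ ∀ t ∈ Set.Ioo (-ε) ε, γ t ∈ 𝓑.horizon) → (∀ p ∈ 𝓑.horizon, 𝓑.metric.leviCivita K p (K p) = 0) → (∀ p ∈ 𝓑.horizon, ∃ W : Set 𝓑.carrier, IsOpen W ∧ p ∈ W ∧ W ⊆ U ∧ ∃ F : 𝓑.carrier → ℝ, ContMDiffOn (𝓡 4) 𝓘(ℝ, ℝ) ((⊤ : ℕ∞) : WithTop ℕ∞) F W ∧ (∀ x ∈ W, x ∈ 𝓑.horizon ↔ F x = 0) ∧ (∀ x ∈ W, x ∈ 𝓑.doc ↔ F x < 0) ∧ ∀ x ∈ W ∩ 𝓑.horizon, ∃ c : ℝ, c ≠ 0 ∧ ∀ w : TangentSpace (𝓡 4) x, mfderiv (𝓡 4) 𝓘(ℝ, ℝ) F x w = c * 𝓑.metric.val x (K x) w) → ∀ V : Set 𝓑.carrier, IsOpen V → 𝓑.horizon ⊆ V → ∃ x ∈ V ∩ 𝓑.doc, 0 < 𝓑.metric.val x (K x) (K x) :=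
  fun hS ↦ stub_nh_assembly stub_nh_gaussNull hS

/-- **The crux body from the four uniqueness facts and the section fact, through the split** (same
statement as `hawkingExtensionIsKerr_of_five_facts'`, now factorised as glue ∘ (A-closer, B-closer);
a consistency check of the split). -/
theorem hawkingExtensionIsKerr_of_subs_of_facts
    (h₁ : SudarskyWald1993_staticity) (h₂ : ChruscielGalloway2010_docStaticUniqueness)
    (h₃ : Chrusciel1997_docAxisymmetricCombination)
    (h₄ : ChruscielCostaHeusler2012_docAxisymmetricUniqueness)
    (hS : chruscielCosta2008_horizonSphericalSection) :
    ∀ (𝓑 : Literature.Geometry.Lorentzian.StationaryAFBlackHole.{0}) [𝓑.metric.HasLeviCivita] [Literature.Geometry.Lorentzian.Kerr.Facts], 𝓑.metric.toPseudoRiemannianMetric.IsRicciFlat → 𝓑.IsIPlusRegular → (∀ p : 𝓑.carrier, p ∈ 𝓑.metric.chronologicalFuture 𝓑.timeOrientation 𝓑.Mext) → (∀ p ∈ 𝓑.doc, 𝓑.killing p ≠ 0) → SimplyConnectedSpace 𝓑.doc → ∀ (U : Set 𝓑.carrier) (K : Π x : 𝓑.carrier, TangentSpace (𝓡 4) x),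 IsOpen U → 𝓑.horizon ⊆ U → IsConnected 𝓑.horizon → ContMDiffOn (𝓡 4) ((𝓡 4).prod 𝓘(ℝ, Literature.Geometry.Lorentzian.E4)) ((⊤ : ℕ∞) : WithTop ℕ∞) (fun x ↦ (Bundle.TotalSpace.mk' Literature.Geometry.Lorentzian.E4 x (K x) : TangentBundle (𝓡 4) 𝓑.carrier)) U → (∀ x ∈ U, ∀ v w : TangentSpace (𝓡 4) x, 𝓑.metric.val x (𝓑.metric.leviCivita K x v) w + 𝓑.metric.val x v (𝓑.metric.leviCivita K x w) = 0) → (∀ x ∈ U, VectorField.mlieBracket (𝓡 4) 𝓑.killing K x = 0) → (∀ p ∈ 𝓑.horizon, K p ≠ 0) → (∀ γ : ℝ → 𝓑.carrier, IsMIntegralCurve γ K → γ 0 ∈ 𝓑.horizon → ∀ t, γ t ∈ 𝓑.horizon) → (∀ x ∈ U ∩ 𝓑.doc, 𝓑.metric.val x (K x) (K x) < 0) → (∃ K' : Π x : 𝓑.carrier, TangentSpace (𝓡 4) x, ContMDiffOn (𝓡 4) ((𝓡 4).prod 𝓘(ℝ, Literature.Geometry.Lorentzian.E4)) ((⊤ :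 ℕ∞) : WithTop ℕ∞) (fun x ↦ (Bundle.TotalSpace.mk' Literature.Geometry.Lorentzian.E4 x (K' x) : TangentBundle (𝓡 4) 𝓑.carrier)) 𝓑.doc ∧ (∀ x ∈ 𝓑.doc, ∀ v w : TangentSpace (𝓡 4) x, 𝓑.metric.val x (𝓑.metric.leviCivita K' x v) w + 𝓑.metric.val x v (𝓑.metric.leviCivita K' x w) = 0) ∧ (∀ x ∈ 𝓑.doc, VectorField.mlieBracket (𝓡 4) 𝓑.killing K' x = 0) ∧ ∃ U' : Set 𝓑.carrier, IsOpen U' ∧ 𝓑.horizon ⊆ U' ∧ ∀ x ∈ U' ∩ 𝓑.doc, K' x = K x) → ∃ (M a : ℝ), Literature.Geometry.Lorentzian.Kerr.IsSubextremal M a ∧ ∃ Ψ : Literature.Geometry.Lorentzian.Kerr.exterior M a → 𝓑.carrier, Function.Injective Ψ ∧ Set.range Ψ = 𝓑.doc ∧ Literature.Geometry.Lorentzian.PseudoRiemannianMetric.IsIsometricImmersion (Literature.Geometry.Lorentzian.Kerr.smoothMetric M a (Literature.Geometry.Lorentzian.Kerr.rPlus M a)).toPseudoRiemannianMetric 𝓑.metric.toPseudoRiemannianMetric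 Ψ :=
  hawkingExtensionIsKerr_of_subs (degenerateHorizonTurnsSpacelike_of_horizonSphericalSection hS)
    (nondegenerateHawkingExtensionIsKerr_of_four_facts h₁ h₂ h₃ h₄)

end Summit.FinalStateConjecture.FinalStateConjecture.Theorems.HawkingExtensionIsKerr.SketchIdeator2

end
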